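import Literature.Barriers.SmoothPoincare4.ExoticOpenFourSpaceOrbitSpaceProofs
import HarnessLib

/-!
# `deMichelisFreedman1992_continuum`: the orbit space `Y` of the end-periodic end is a smooth manifold (§0, §2)

Proof file (definitions of the atlas + theorems; sibling of `ExoticOpenFourSpaceOrbitSpaceProofs`)
in the cone of the named fact
`Literature.Barriers.SmoothPoincare4.deMichelisFreedman1992_continuum` (DeMichelis–Freedman 1992,
Thm. 4.1 with Cor. 4.1).

`ExoticOpenFourSpaceEndPeriodicProofs` renders the end produced by a diffeomorphism
`(R⁴_s, K) ≅ (R⁴_t, K)`, `s < t` (the self-map `σ = incl ∘ d⁻¹` of `X = R⁴_t`, the end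
compactum, the covering action, Taubes' height function `τ`), and
`ExoticOpenFourSpaceOrbitSpaceProofs` its orbit space `Y = (X ∖ ⋂ₖ σ^[k](X))/(pt ∼ σ(pt))` as a
compact Hausdorff space. The source says more (§0, p. 220: "the quotient `Y` is a smooth
manifold"; §2, p. 223: "The quotient `Y = (R⁴ ∖ ⋂ R⁴_k)/pt ∼ d(pt)` has a natural smooth
structure"). THIS FILE proves it: `Y` carries a `C^∞` atlas modelled on the ambient vector space
`E` (`ℝ⁴` in the tree) in which the projection is, in coordinates, the identity.

Construction and results (namespace `EndPeriodic`; `X = U` an open subset of `E`,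
`σ = incl ∘ φ⁻¹` for a diffeomorphism `φ : V ≅ U` of open subsets `V ⊆ U`, `σ(U) ⊆ C` compact):
* `heightFun`, `heightFun_spec`, `heightFun_iterate` — a chosen height function
  (`exists_height_function`) and its shift law `τ (σ^[j] y) = τ y + j`;
* `window`, `injOn_mk_window`, `mkWindow` — on the window `{|τ - τ x| < 1/4}` of a point `x` the
  projection to `Y` is injective (two lifts differ by `σ^[j]` with `|j| < 1/2`), giving a local
  inverse of the projection as an open partial homeomorphism (the projection is open,
  `isOpenMap_mk`);
* `coordChart`, `orbitChart`, `orbitChart_mk`, `orbitChartedSpace` — the chart at `x`: local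
  inverse of the projection followed by the inclusion `X ∖ ⋂ₖ σ^[k](X) ⊆ U ⊆ E`; it sends the
  class of `y` in the window of `x` to the coordinates of `y`; these charts form an atlas;
* `orbitChart_transition`, `contDiffOn_orbitChart_transition` — the transition map between the
  charts at `x₁`, `x₂` sends the coordinates of a lift `y` (window of `x₁`) to those of the lift
  `y'` (window of `x₂`) of the same class; `y' = σ^[k] y` or `y = σ^[-k] y'` for a signed
  integer `k` which the heights pin down on the whole (connected or not) source (`k` lies in an
  open interval of length `1` determined by `τ x₁`, `τ x₂`), so the transition map is `G^[k]` or
  `F^[-k]` there, `F`, `G` ambient `C^∞` extensions of `φ`, `φ⁻¹`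
  (`exists_extend_diffeomorph`) — `C^∞`;
* `isManifold_orbitSpace` — hence `IsManifold 𝓘(ℝ, E) ∞ Y` for this atlas;
* `isManifold_orbitSpace_inclusion_comp_symm` — the same for the polar family of the tree's
  reduction (`d : R⁴_s ≅ R⁴_t`, `s < t`, `s < 1`, `C` the closed polar ball).

NOT rendered (absent from Mathlib or out of reach): the Riemannian metric on `Y`, the
end-periodic metrics `B_n`, `Q_n`, `B_∞ ≅ Q_∞`, and the gauge theory (`Φ`, Thm. 2.1). No named
fact is introduced (D-0026).

## References

* S. DeMichelis, M. H. Freedman, *Uncountably many exotic `R⁴`'s in standard 4-space*,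
  J. Differential Geom. 35 (1992) 219–254: §0 (p. 220), §2 (pp. 222–223), proof of Thm. 4.1
  (p. 247) [DeMichelisFreedman1992].

[DeMichelisFreedman1992]
-/

noncomputable section

open scoped Manifold ContDiff Topology
open TopologicalSpace Set Function Filter Topology

namespace Literature.Barriers.SmoothPoincare4

namespace EndPeriodic

section General

variable {X : Type*} {σ : X → X} {C : Set X}

/-- Iterates of a map of `s` into itself stay in `s`. [folklore] -/
theorem iterate_mem_of_mapsTo {α : Type*} {G : α → α} {s : Set α} (hs : MapsTo G s s) (i : ℕ)
    {p : α} (hp : p ∈ s) : G^[i] p ∈ s := by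
  induction i with
  | zero => exact hp
  | succ i ih => rw [Function.iterate_succ_apply']; exact hs ih

/-- `F^[i] ∘ G^[i] = id` on `s` when `F ∘ G = id` on `s` and `G` maps `s` into itself.
[folklore] -/
theorem iterate_apply_iterate_apply_of_leftInverse {α : Type*} {F G : α → α} {s : Set α}
    (hs : MapsTo G s s) (hFG : ∀ p ∈ s, F (G p) = p) :
    ∀ (i : ℕ) (p : α), p ∈ s → F^[i] (G^[i] p) = p
  | 0, _, _ => rfl
  | i + 1, p, hp => by
    rw [Function.iterate_succ_apply', Function.iterate_succ_apply,
      iterate_apply_iterate_apply_of_leftInverse hs hFG i (G p) (hs hp), hFG p hp]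

/-! #### Windows of the height function: open sets on which the projection is injective -/

/-- The window of `x`: points whose height differs from that of `x` by less than `1/4`. [folklore] -/
def window (τ : X → ℝ) (x : EndCompl σ) : Set (EndCompl σ) := {y | |τ y - τ x| < 1 / 4}

/-- `x` lies in its own window. [folklore] -/
theorem mem_window_self (τ : X → ℝ) (x : EndCompl σ) : x ∈ window τ x := by
  simp [window]

/-- **The projection to the orbit space is injective on each window**: two points of a window
with the same image differ by an iterate `σ^[j]`, so their heights differ by the integer `j`,
which is `< 1/2` in absolute value, whence `j = 0`. [folklore] -/
theorem injOn_mk_window (hinj : Injective σ) {τ : X → ℝ}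
    (hshift : ∀ (j : ℕ) (y : EndCompl σ), τ (σ^[j] y) = τ y + j) (x : EndCompl σ) :
    InjOn (Quotient.mk (orbitSetoid σ) : EndCompl σ → OrbitSpace σ) (window τ x) := by
  intro y₁ h₁ y₂ h₂ h
  simp only [window, mem_setOf_eq] at h₁ h₂
  have key : ∀ {a b : EndCompl σ} (j : ℕ), |τ a - τ x| < 1 / 4 → |τ b - τ x| < 1 / 4 →
      (a : X) = σ^[j] b → a = b := by
    intro a b j ha hb hab
    have hτ : τ a = τ b + j := by rw [hab]; exact hshift j b
    have hj : (j : ℝ) < 1 := by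
      rw [abs_lt] at ha hb
      linarith
    have hj0 : j = 0 := Nat.lt_one_iff.1 (by exact_mod_cast hj)
    subst hj0
    exact Subtype.ext hab
  rcases (mk_eq_mk_iff hinj).1 h with ⟨j, hj⟩ | ⟨j, hj⟩
  · exact key j h₁ h₂ hj
  · exact (key j h₂ h₁ hj).symm

variable [TopologicalSpace X]

/-! #### A chosen height function -/

/-- **A chosen Taubes height function** (`exists_height_function`). [cite: DeMichelisFreedman1992, §2 (p. 223)] -/
def heightFun [T2Space X] [LocallyCompactSpace X] (hσ : IsOpenEmbedding σ) (hC : IsCompact C)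
    (hσC : range σ ⊆ C) : X → ℝ :=
  Classical.choose (exists_height_function hσ hC hσC)

/-- The defining properties of the chosen height function. [cite: DeMichelisFreedman1992, §2 (p. 223)] -/
theorem heightFun_spec [T2Space X] [LocallyCompactSpace X] (hσ : IsOpenEmbedding σ)
    (hC : IsCompact C) (hσC : range σ ⊆ C) :
    ContinuousOn (heightFun hσ hC hσC) (⋂ k, range (σ^[k]))ᶜ ∧ (∀ x, 0 ≤ heightFun hσ hC hσC x) ∧
      (∀ x, x ∉ (⋂ k, range (σ^[k])) → heightFun hσ hC hσC (σ x) = heightFun hσ hC hσC x + 1) ∧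
      (∀ (k : ℕ) (x : X), x ∉ (⋂ k, range (σ^[k])) → x ∈ range (σ^[k]) →
        (k : ℝ) ≤ heightFun hσ hC hσC x) ∧
      (∀ (k : ℕ) (x : X), x ∉ range (σ^[k]) → heightFun hσ hC hσC x ≤ k) :=
  Classical.choose_spec (exists_height_function hσ hC hσC)

/-- The chosen height function is continuous on the complement of the end compactum (as a type). [folklore] -/
theorem continuous_heightFun_coe [T2Space X] [LocallyCompactSpace X] (hσ : IsOpenEmbedding σ)
    (hC : IsCompact C) (hσC : range σ ⊆ C) :
    Continuous fun y : EndCompl σ => heightFun hσ hC hσC y :=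
  (heightFun_spec hσ hC hσC).1.comp_continuous continuous_subtype_val fun y => y.2

/-- The shift law along iterates for the chosen height function. [cite: DeMichelisFreedman1992, §2 (p. 223)] -/
theorem heightFun_iterate [T2Space X] [LocallyCompactSpace X] (hσ : IsOpenEmbedding σ)
    (hC : IsCompact C) (hσC : range σ ⊆ C) (j : ℕ) (y : EndCompl σ) :
    heightFun hσ hC hσC (σ^[j] y) = heightFun hσ hC hσC y + j :=
  apply_iterate_eq_add_of_shift hσ.injective (heightFun_spec hσ hC hσC).2.2.1 j y y.2

/-- Windows are open when the height function is continuous. [folklore] -/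
theorem isOpen_window {τ : X → ℝ} (hτ : Continuous fun y : EndCompl σ => τ y) (x : EndCompl σ) :
    IsOpen (window τ x) :=
  isOpen_lt (continuous_abs.comp (hτ.sub continuous_const)) continuous_const

/-- **The local inverse of the projection on a window**, as an open partial homeomorphism from the
complement of the end compactum to the orbit space with source the window of `x`. [folklore] -/
def mkWindow (hσ : IsOpenEmbedding σ) (hopen : IsOpen (⋂ k, range (σ^[k]))ᶜ) {τ : X → ℝ}
    (hτ : Continuous fun y : EndCompl σ => τ y)
    (hshift : ∀ (j : ℕ) (y : EndCompl σ), τ (σ^[j] y) = τ y + j) (x : EndCompl σ) :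
    OpenPartialHomeomorph (EndCompl σ) (OrbitSpace σ) :=
  haveI : Nonempty (EndCompl σ) := ⟨x⟩
  OpenPartialHomeomorph.ofContinuousOpen
    ((injOn_mk_window hσ.injective hshift x).toPartialEquiv _ _)
    continuous_mk.continuousOn (isOpenMap_mk hσ hopen) (isOpen_window hτ x)

/-- The source of `mkWindow x` is the window of `x`. [folklore] -/
theorem mkWindow_source (hσ : IsOpenEmbedding σ) (hopen : IsOpen (⋂ k, range (σ^[k]))ᶜ)
    {τ : X → ℝ} (hτ : Continuous fun y : EndCompl σ => τ y)
    (hshift : ∀ (j : ℕ) (y : EndCompl σ), τ (σ^[j] y) = τ y + j) (x : EndCompl σ) :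
    (mkWindow hσ hopen hτ hshift x).source = window τ x :=
  rfl

/-- The target of `mkWindow x` is the image of the window of `x` in the orbit space. [folklore] -/
theorem mkWindow_target (hσ : IsOpenEmbedding σ) (hopen : IsOpen (⋂ k, range (σ^[k]))ᶜ)
    {τ : X → ℝ} (hτ : Continuous fun y : EndCompl σ => τ y)
    (hshift : ∀ (j : ℕ) (y : EndCompl σ), τ (σ^[j] y) = τ y + j) (x : EndCompl σ) :
    (mkWindow hσ hopen hτ hshift x).target =
      (Quotient.mk (orbitSetoid σ) : EndCompl σ → OrbitSpace σ) '' window τ x :=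
  rfl

/-- `mkWindow x` is the projection. [folklore] -/
@[simp] theorem mkWindow_apply (hσ : IsOpenEmbedding σ) (hopen : IsOpen (⋂ k, range (σ^[k]))ᶜ)
    {τ : X → ℝ} (hτ : Continuous fun y : EndCompl σ => τ y)
    (hshift : ∀ (j : ℕ) (y : EndCompl σ), τ (σ^[j] y) = τ y + j) (x y : EndCompl σ) :
    mkWindow hσ hopen hτ hshift x y = Quotient.mk (orbitSetoid σ) y :=
  rfl

end General

/-! #### Charts of the orbit space of a self-embedding of an open subset of a vector space -/

section Charts

variable {E : Type*} [NormedAddCommGroup E] {U : Opens E} {σ : U → U} {C : Set U}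

/-- The coordinate embedding of the complement of the end compactum into the model space `E`
(`X = U` an open subset of `E`). [folklore] -/
def coordEmb (σ : U → U) : EndCompl σ → E := fun y => ((y : U) : E)

/-- The coordinate embedding is the double coercion. [folklore] -/
@[simp] theorem coordEmb_apply (σ : U → U) (y : EndCompl σ) : coordEmb σ y = ((y : U) : E) :=
  rfl

/-- The coordinate embedding is injective. [folklore] -/
theorem coordEmb_injective (σ : U → U) : Injective (coordEmb σ) := fun _ _ h =>
  Subtype.ext (Subtype.ext h)

/-- The coordinate embedding is an open embedding (the complement of the end compactum is open
in `U`, which is open in `E`). [folklore] -/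
theorem isOpenEmbedding_coordEmb (hopen : IsOpen (⋂ k, range (σ^[k]))ᶜ) :
    IsOpenEmbedding (coordEmb σ) :=
  U.isOpenEmbedding'.comp hopen.isOpenEmbedding_subtypeVal

/-- The coordinate embedding as an open partial homeomorphism with source everything. [folklore] -/
def coordChart (hopen : IsOpen (⋂ k, range (σ^[k]))ᶜ) (x : EndCompl σ) :
    OpenPartialHomeomorph (EndCompl σ) E :=
  haveI : Nonempty (EndCompl σ) := ⟨x⟩
  (isOpenEmbedding_coordEmb hopen).toOpenPartialHomeomorph (coordEmb σ)

/-- The coordinate chart is defined everywhere. [folklore] -/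
theorem coordChart_source (hopen : IsOpen (⋂ k, range (σ^[k]))ᶜ) (x : EndCompl σ) :
    (coordChart hopen x).source = univ := by
  haveI : Nonempty (EndCompl σ) := ⟨x⟩
  exact (isOpenEmbedding_coordEmb hopen).toOpenPartialHomeomorph_source _

/-- The coordinate chart is the coordinate embedding. [folklore] -/
@[simp] theorem coordChart_apply (hopen : IsOpen (⋂ k, range (σ^[k]))ᶜ) (x y : EndCompl σ) :
    coordChart hopen x y = ((y : U) : E) := by
  haveI : Nonempty (EndCompl σ) := ⟨x⟩
  exact congr_fun ((isOpenEmbedding_coordEmb hopen).toOpenPartialHomeomorph_apply _) y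

/-- The inverse coordinate chart on coordinates of a point is that point. [folklore] -/
theorem coordChart_symm_apply (hopen : IsOpen (⋂ k, range (σ^[k]))ᶜ) (x y : EndCompl σ) :
    (coordChart hopen x).symm ((y : U) : E) = y := by
  haveI : Nonempty (EndCompl σ) := ⟨x⟩
  exact (isOpenEmbedding_coordEmb hopen).toOpenPartialHomeomorph_left_inv _

variable [LocallyCompactSpace U]

/-- **The chart of the orbit space at (the image of) `x`**: the inverse of the projection on the
window of `x` followed by the coordinate embedding into `E`. [cite: DeMichelisFreedman1992, §0 (p. 220), §2 (p. 223)] -/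
def orbitChart (hσ : IsOpenEmbedding σ) (hC : IsCompact C) (hσC : range σ ⊆ C) (x : EndCompl σ) :
    OpenPartialHomeomorph (OrbitSpace σ) E :=
  (mkWindow hσ (isClosed_iInter_range_iterate hσ.continuous hC hσC).isOpen_compl
      (continuous_heightFun_coe hσ hC hσC) (heightFun_iterate hσ hC hσC) x).symm.trans
    (coordChart (isClosed_iInter_range_iterate hσ.continuous hC hσC).isOpen_compl x)

/-- The source of the chart at `x` is the image of the window of `x`. [folklore] -/
theorem orbitChart_source (hσ : IsOpenEmbedding σ) (hC : IsCompact C) (hσC : range σ ⊆ C)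
    (x : EndCompl σ) :
    (orbitChart hσ hC hσC x).source =
      (Quotient.mk (orbitSetoid σ) : EndCompl σ → OrbitSpace σ) ''
        window (heightFun hσ hC hσC) x := by
  rw [orbitChart, OpenPartialHomeomorph.trans_source, OpenPartialHomeomorph.symm_source,
    mkWindow_target, coordChart_source, preimage_univ, inter_univ]

/-- Classes of points of the window of `x` lie in the source of the chart at `x`. [folklore] -/
theorem mk_mem_orbitChart_source (hσ : IsOpenEmbedding σ) (hC : IsCompact C) (hσC : range σ ⊆ C)
    {x y : EndCompl σ} (hy : y ∈ window (heightFun hσ hC hσC) x) :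
    (Quotient.mk (orbitSetoid σ) y : OrbitSpace σ) ∈ (orbitChart hσ hC hσC x).source := by
  rw [orbitChart_source]
  exact mem_image_of_mem _ hy

/-- **The chart at `x` sends the class of `y` in the window of `x` to the coordinates of `y`.**
[cite: DeMichelisFreedman1992, §2 (p. 223)] -/
theorem orbitChart_mk (hσ : IsOpenEmbedding σ) (hC : IsCompact C) (hσC : range σ ⊆ C)
    {x y : EndCompl σ} (hy : y ∈ window (heightFun hσ hC hσC) x) :
    orbitChart hσ hC hσC x (Quotient.mk (orbitSetoid σ) y) = ((y : U) : E) := by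
  rw [orbitChart, OpenPartialHomeomorph.trans_apply]
  have h := (mkWindow hσ (isClosed_iInter_range_iterate hσ.continuous hC hσC).isOpen_compl
    (continuous_heightFun_coe hσ hC hσC) (heightFun_iterate hσ hC hσC) x).left_inv
    (x := y) (by rwa [mkWindow_source])
  rw [mkWindow_apply] at h
  rw [h, coordChart_apply]

/-- The inverse chart is the projection of the inverse coordinate embedding. [folklore] -/
theorem orbitChart_symm_apply_coe (hσ : IsOpenEmbedding σ) (hC : IsCompact C)
    (hσC : range σ ⊆ C) (x y : EndCompl σ) :
    (orbitChart hσ hC hσC x).symm ((y : U) : E) = Quotient.mk (orbitSetoid σ) y := by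
  rw [orbitChart, OpenPartialHomeomorph.trans_symm_eq_symm_trans_symm,
    OpenPartialHomeomorph.trans_apply, OpenPartialHomeomorph.symm_symm, coordChart_symm_apply,
    mkWindow_apply]

/-- Points of the target of a chart are coordinates of points of the window. [folklore] -/
theorem exists_of_mem_orbitChart_target (hσ : IsOpenEmbedding σ) (hC : IsCompact C)
    (hσC : range σ ⊆ C) {x : EndCompl σ} {p : E} (hp : p ∈ (orbitChart hσ hC hσC x).target) :
    ∃ y ∈ window (heightFun hσ hC hσC) x, p = ((y : U) : E) := by
  have hopen : IsOpen (⋂ k, range (σ^[k]))ᶜ :=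
    (isClosed_iInter_range_iterate hσ.continuous hC hσC).isOpen_compl
  rw [orbitChart, OpenPartialHomeomorph.trans_target] at hp
  refine ⟨(coordChart hopen x).symm p, ?_, ?_⟩
  · have := hp.2
    rwa [mem_preimage, OpenPartialHomeomorph.symm_target, mkWindow_source] at this
  · have := (coordChart hopen x).right_inv hp.1
    rw [coordChart_apply] at this
    exact this.symm

/-- **The smooth atlas of the orbit space**: the charts `orbitChart x`, `x` off the end
compactum; the chart at a class is the chart at a chosen representative.
[cite: DeMichelisFreedman1992, §0 (p. 220), §2 (p. 223)] -/
@[reducible] def orbitChartedSpace (hσ : IsOpenEmbedding σ) (hC : IsCompact C)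
    (hσC : range σ ⊆ C) : ChartedSpace E (OrbitSpace σ) where
  atlas := range (orbitChart hσ hC hσC)
  chartAt q := orbitChart hσ hC hσC q.out
  mem_chart_source q := by
    have h := mk_mem_orbitChart_source hσ hC hσC (mem_window_self (heightFun hσ hC hσC) q.out)
    rwa [Quotient.out_eq] at h
  chart_mem_atlas q := mem_range_self _

/-- **The transition between two charts, pointwise.** For `p` in the source of
`(orbitChart x₁)⁻¹ ≫ orbitChart x₂` there are `y` in the window of `x₁` and `y'` in the window
of `x₂` with the same class, `p` the coordinates of `y` and the transition map sending `p` to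
the coordinates of `y'`. [folklore] -/
theorem orbitChart_transition (hσ : IsOpenEmbedding σ) (hC : IsCompact C) (hσC : range σ ⊆ C)
    (x₁ x₂ : EndCompl σ) {p : E}
    (hp : p ∈ ((orbitChart hσ hC hσC x₁).symm.trans (orbitChart hσ hC hσC x₂)).source) :
    ∃ y ∈ window (heightFun hσ hC hσC) x₁, ∃ y' ∈ window (heightFun hσ hC hσC) x₂,
      p = ((y : U) : E) ∧
      (Quotient.mk (orbitSetoid σ) y : OrbitSpace σ) = Quotient.mk (orbitSetoid σ) y' ∧
      ((orbitChart hσ hC hσC x₁).symm.trans (orbitChart hσ hC hσC x₂)) p = ((y' : U) : E) := by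
  rw [OpenPartialHomeomorph.trans_source, OpenPartialHomeomorph.symm_source] at hp
  obtain ⟨y, hy, rfl⟩ := exists_of_mem_orbitChart_target hσ hC hσC hp.1
  have h2 : (Quotient.mk (orbitSetoid σ) y : OrbitSpace σ) ∈ (orbitChart hσ hC hσC x₂).source := by
    have := hp.2
    rwa [mem_preimage, orbitChart_symm_apply_coe] at this
  rw [orbitChart_source] at h2
  obtain ⟨y', hy', hyy'⟩ := h2
  refine ⟨y, hy, y', hy', rfl, hyy'.symm, ?_⟩
  rw [OpenPartialHomeomorph.trans_apply, orbitChart_symm_apply_coe, ← hyy', orbitChart_mk _ _ _ hy']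

end Charts

/-! #### Smoothness of the transition maps for `σ = incl ∘ φ⁻¹`, `φ : V ≅ U` a diffeomorphism of open subsets of `E` -/

section Smooth

variable {E : Type*} [NormedAddCommGroup E] [NormedSpace ℝ E] {U V : Opens E}

/-- Two integers within `1/2` of the same real number coincide. [folklore] -/
theorem int_eq_of_mem_Ioo {c : ℝ} {a b : ℤ} (ha : (a : ℝ) ∈ Ioo (c - 1 / 2) (c + 1 / 2))
    (hb : (b : ℝ) ∈ Ioo (c - 1 / 2) (c + 1 / 2)) : a = b := by
  have h : |((a - b : ℤ) : ℝ)| < 1 := by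
    push_cast
    rw [abs_lt]
    constructor <;> linarith [ha.1, ha.2, hb.1, hb.2]
  have h' : |a - b| < 1 := by exact_mod_cast h
  linarith [Int.abs_lt_one_iff.1 h']

/-- The self-map `σ = incl ∘ φ⁻¹` of `U` is an open embedding (`φ : V ≅ U` a diffeomorphism of
open subsets `V ⊆ U` of `E`). [cite: DeMichelisFreedman1992, §2 (pp. 222–223)] -/
theorem isOpenEmbedding_inclusion_comp_symm_opens (hVU : V ≤ U)
    (φ : V ≃ₘ⟮𝓘(ℝ, E), 𝓘(ℝ, E)⟯ U) : IsOpenEmbedding (Opens.inclusion hVU ∘ φ.symm) :=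
  (Opens.isOpenEmbedding_of_le hVU).comp φ.symm.toHomeomorph.isOpenEmbedding

/-- Iterating a map of `s` into itself which is `C^∞` on `s`. [folklore] -/
theorem contDiffOn_iterate {G : E → E} {s : Set E} (hG : ContDiffOn ℝ ∞ G s)
    (hs : MapsTo G s s) : ∀ i : ℕ, ContDiffOn ℝ ∞ (G^[i]) s
  | 0 => contDiffOn_id
  | i + 1 => by
    rw [Function.iterate_succ]
    exact (contDiffOn_iterate hG hs i).comp hG hs

/-- `F^[i]` is `C^∞` on `G^[i](s)` when `F` is `C^∞` on `G(s)`, `F ∘ G = id` on `s` and `G` maps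
`s` into itself. [folklore] -/
theorem contDiffOn_iterate_image {F G : E → E} {s : Set E} (hs : MapsTo G s s)
    (hF : ContDiffOn ℝ ∞ F (G '' s)) (hFG : ∀ p ∈ s, F (G p) = p) :
    ∀ i : ℕ, ContDiffOn ℝ ∞ (F^[i]) ((G^[i]) '' s)
  | 0 => by simpa using contDiffOn_id
  | i + 1 => by
    rw [Function.iterate_succ]
    have himg : (G^[i + 1]) '' s = G '' ((G^[i]) '' s) := by
      rw [image_image]
      exact image_congr fun p _ => Function.iterate_succ_apply' G i p
    rw [himg]
    refine (contDiffOn_iterate_image hs hF hFG i).comp (hF.mono ?_) ?_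
    · exact image_mono (image_subset_iff.2 fun p hp => iterate_mem_of_mapsTo hs i hp)
    · rintro _ ⟨q, ⟨p, hp, rfl⟩, rfl⟩
      rw [hFG _ (iterate_mem_of_mapsTo hs i hp)]
      exact ⟨p, hp, rfl⟩

/-- The coordinates of `σ^[i] u` are `G^[i]` of the coordinates of `u`, for any `G` extending
`φ⁻¹`. [folklore] -/
theorem coe_iterate_inclusion_comp_symm (hVU : V ≤ U) (φ : V ≃ₘ⟮𝓘(ℝ, E), 𝓘(ℝ, E)⟯ U)
    {G : E → E} (hG : ∀ u : U, G u = φ.symm u) (i : ℕ) (u : U) :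
    (((Opens.inclusion hVU ∘ φ.symm)^[i] u : U) : E) = G^[i] u := by
  induction i with
  | zero => rfl
  | succ i ih =>
    rw [Function.iterate_succ_apply', Function.iterate_succ_apply', ← ih]
    exact (hG _).symm

variable [LocallyCompactSpace U]

/-- **The transition maps of the atlas of the orbit space are `C^∞`.** For
`σ = incl ∘ φ⁻¹ : U → U` (`φ : V ≅ U` a diffeomorphism of open subsets of `E`, `σ(U) ⊆ C`
compact) and charts at `x₁`, `x₂`: on the (possibly empty) source of
`(orbitChart x₁)⁻¹ ≫ orbitChart x₂` the signed integer `k`, `y' = σ^[k] y` or `y = σ^[-k] y'`,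
relating the two lifts is pinned down by the heights (both lifts lie in windows of radius `1/4`,
so `k` lies in an open interval of length `1`), hence the transition map coincides on its whole
source with `G^[k]` (`G` an ambient `C^∞` extension of `φ⁻¹`) or with `F^[-k]` (`F` one of
`φ`) — both `C^∞` there. [cite: DeMichelisFreedman1992, §0 (p. 220), §2 (p. 223)] -/
theorem contDiffOn_orbitChart_transition (hVU : V ≤ U) (φ : V ≃ₘ⟮𝓘(ℝ, E), 𝓘(ℝ, E)⟯ U)
    {C : Set U} (hC : IsCompact C) (hσC : range (Opens.inclusion hVU ∘ φ.symm) ⊆ C)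
    (x₁ x₂ : EndCompl (Opens.inclusion hVU ∘ φ.symm)) :
    ContDiffOn ℝ ∞
      ((orbitChart (isOpenEmbedding_inclusion_comp_symm_opens hVU φ) hC hσC x₁).symm.trans
        (orbitChart (isOpenEmbedding_inclusion_comp_symm_opens hVU φ) hC hσC x₂))
      ((orbitChart (isOpenEmbedding_inclusion_comp_symm_opens hVU φ) hC hσC x₁).symm.trans
        (orbitChart (isOpenEmbedding_inclusion_comp_symm_opens hVU φ) hC hσC x₂)).source := by
  set hσ := isOpenEmbedding_inclusion_comp_symm_opens hVU φ with hσ_def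
  obtain ⟨F, G, hF, hG, -, hGφ, -, hGV, -, hFG⟩ := exists_extend_diffeomorph V U φ
  have hGU : MapsTo G (U : Set E) U := fun p hp => hVU (hGV p hp)
  have hFV : ContDiffOn ℝ ∞ F (G '' (U : Set E)) := hF.mono (by
    rintro _ ⟨p, hp, rfl⟩
    exact hGV p hp)
  have hGi : ∀ i, ContDiffOn ℝ ∞ (G^[i]) (U : Set E) := contDiffOn_iterate hG hGU
  have hFi : ∀ i, ContDiffOn ℝ ∞ (F^[i]) ((G^[i]) '' (U : Set E)) :=
    contDiffOn_iterate_image hGU hFV hFG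
  have hcoe : ∀ (i : ℕ) (u : U), (((Opens.inclusion hVU ∘ φ.symm)^[i] u : U) : E) = G^[i] u :=
    coe_iterate_inclusion_comp_symm hVU φ hGφ
  have hFGi := iterate_apply_iterate_apply_of_leftInverse hGU hFG
  -- heights of points of the two windows
  have hwin : ∀ {y y' : EndCompl (Opens.inclusion hVU ∘ φ.symm)},
      y ∈ window (heightFun hσ hC hσC) x₁ → y' ∈ window (heightFun hσ hC hσC) x₂ →
        heightFun hσ hC hσC y' - heightFun hσ hC hσC y ∈
          Ioo (heightFun hσ hC hσC x₂ - heightFun hσ hC hσC x₁ - 1 / 2)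
            (heightFun hσ hC hσC x₂ - heightFun hσ hC hσC x₁ + 1 / 2) := by
    intro y y' hy hy'
    simp only [window, mem_setOf_eq, abs_lt] at hy hy'
    constructor <;> linarith [hy.1, hy.2, hy'.1, hy'.2]
  -- the signed integer of a related pair, through the heights
  have hB : ∀ {y y' : EndCompl (Opens.inclusion hVU ∘ φ.symm)} (i : ℕ),
      (y' : U) = (Opens.inclusion hVU ∘ φ.symm)^[i] y →
        heightFun hσ hC hσC y' - heightFun hσ hC hσC y = i := by
    intro y y' i h
    have := heightFun_iterate hσ hC hσC i y
    rw [← h] at this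
    linarith
  have hA : ∀ {y y' : EndCompl (Opens.inclusion hVU ∘ φ.symm)} (i : ℕ),
      (y : U) = (Opens.inclusion hVU ∘ φ.symm)^[i] y' →
        heightFun hσ hC hσC y' - heightFun hσ hC hσC y = -i := by
    intro y y' i h
    have := heightFun_iterate hσ hC hσC i y'
    rw [← h] at this
    linarith
  set T := (orbitChart hσ hC hσC x₁).symm.trans (orbitChart hσ hC hσC x₂) with hT_def
  rcases T.source.eq_empty_or_nonempty with hS | ⟨p₀, hp₀⟩
  · rw [hS]
    exact contDiffOn_empty
  obtain ⟨y₀, hy₀, y₀', hy₀', -, hrel₀, -⟩ := orbitChart_transition hσ hC hσC x₁ x₂ hp₀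
  have hI₀ := hwin hy₀ hy₀'
  rcases (mk_eq_mk_iff hσ.injective).1 hrel₀ with ⟨i₀, hi₀⟩ | ⟨i₀, hi₀⟩
  · -- at `p₀` the first lift is an iterate of the second: `T = F^[i₀]` on the whole source
    rw [hA i₀ hi₀] at hI₀
    have key : ∀ p ∈ T.source, T p = F^[i₀] p ∧ p ∈ (G^[i₀]) '' (U : Set E) := by
      intro p hp
      obtain ⟨y, hy, y', hy', rfl, hrel, hTp⟩ := orbitChart_transition hσ hC hσC x₁ x₂ hp
      rw [← hT_def] at hTp
      have hI := hwin hy hy'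
      rcases (mk_eq_mk_iff hσ.injective).1 hrel with ⟨i, hi⟩ | ⟨i, hi⟩
      · rw [hA i hi] at hI
        have hii : i = i₀ := by
          have := int_eq_of_mem_Ioo (a := -(i : ℤ)) (b := -(i₀ : ℤ)) (by push_cast; exact hI)
            (by push_cast; exact hI₀)
          omega
        subst hii
        have h1 : ((y : U) : E) = G^[i] ((y' : U) : E) := by
          rw [hi]
          exact hcoe i _
        refine ⟨?_, (y' : U), (y' : U).2, h1.symm⟩
        rw [hTp, h1, hFGi i _ (y' : U).2]
      · rw [hB i hi] at hI
        have h0 : i = 0 ∧ i₀ = 0 := by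
          have := int_eq_of_mem_Ioo (a := (i : ℤ)) (b := -(i₀ : ℤ)) (by push_cast; exact hI)
            (by push_cast; exact hI₀)
          omega
        obtain ⟨rfl, rfl⟩ := h0
        have hyy : y' = y := Subtype.ext (by simpa using hi)
        subst hyy
        exact ⟨by rw [hTp]; rfl, (y' : U), (y' : U).2, rfl⟩
    exact (hFi i₀).congr_mono (fun p hp => (key p hp).1) fun p hp => (key p hp).2
  · -- at `p₀` the second lift is an iterate of the first: `T = G^[i₀]` on the whole source
    rw [hB i₀ hi₀] at hI₀
    have key : ∀ p ∈ T.source, T p = G^[i₀] p ∧ p ∈ (U : Set E) := by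
      intro p hp
      obtain ⟨y, hy, y', hy', rfl, hrel, hTp⟩ := orbitChart_transition hσ hC hσC x₁ x₂ hp
      rw [← hT_def] at hTp
      have hI := hwin hy hy'
      refine ⟨?_, (y : U).2⟩
      rcases (mk_eq_mk_iff hσ.injective).1 hrel with ⟨i, hi⟩ | ⟨i, hi⟩
      · rw [hA i hi] at hI
        have h0 : i = 0 ∧ i₀ = 0 := by
          have := int_eq_of_mem_Ioo (a := -(i : ℤ)) (b := (i₀ : ℤ)) (by push_cast; exact hI)
            (by push_cast; exact hI₀)
          omega
        obtain ⟨rfl, rfl⟩ := h0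
        have hyy : y = y' := Subtype.ext (by simpa using hi)
        subst hyy
        rw [hTp]
        rfl
      · rw [hB i hi] at hI
        have hii : i = i₀ := by
          have := int_eq_of_mem_Ioo (a := (i : ℤ)) (b := (i₀ : ℤ)) (by push_cast; exact hI)
            (by push_cast; exact hI₀)
          omega
        subst hii
        rw [hTp, hi]
        exact hcoe i _
    exact (hGi i₀).congr_mono (fun p hp => (key p hp).1) fun p hp => (key p hp).2

/-- **The orbit space `Y` is a smooth manifold** ("the quotient `Y` is a smooth manifold", §0,
p. 220; "`Y` … has a natural smooth structure", §2, p. 223): for `σ = incl ∘ φ⁻¹ : U → U`,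
`φ : V ≅ U` a diffeomorphism of open subsets `V ⊆ U` of `E` with `σ(U) ⊆ C` compact (`U`
locally compact, e.g. `E` finite-dimensional), the atlas `orbitChartedSpace` — local inverses of
the projection followed by the inclusion in `E`, so that in these charts the projection is the
identity on coordinates (`orbitChart_mk`) — is a `C^∞` atlas modelled on `E`.
[cite: DeMichelisFreedman1992, §0 (p. 220), §2 (p. 223)] -/
theorem isManifold_orbitSpace (hVU : V ≤ U) (φ : V ≃ₘ⟮𝓘(ℝ, E), 𝓘(ℝ, E)⟯ U) {C : Set U}
    (hC : IsCompact C) (hσC : range (Opens.inclusion hVU ∘ φ.symm) ⊆ C) :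
    letI := orbitChartedSpace (isOpenEmbedding_inclusion_comp_symm_opens hVU φ) hC hσC
    IsManifold 𝓘(ℝ, E) ∞ (OrbitSpace (Opens.inclusion hVU ∘ φ.symm)) := by
  letI := orbitChartedSpace (isOpenEmbedding_inclusion_comp_symm_opens hVU φ) hC hσC
  refine isManifold_of_contDiffOn 𝓘(ℝ, E) ∞ (OrbitSpace (Opens.inclusion hVU ∘ φ.symm)) ?_
  rintro e e' ⟨x₁, rfl⟩ ⟨x₂, rfl⟩
  simpa only [modelWithCornersSelf_coe, modelWithCornersSelf_coe_symm, Function.id_comp,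
    Function.comp_id, Set.range_id, Set.preimage_id, Set.inter_univ] using
    contDiffOn_orbitChart_transition hVU φ hC hσC x₁ x₂

end Smooth

end EndPeriodic

/-! ### The polar family: the orbit space of the end produced by `d : R⁴_s ≅ R⁴_t` is a smooth manifold -/

section PolarOrbitManifold

variable {E : Type*} [NormedAddCommGroup E] [NormedSpace ℝ E] [ProperSpace E]
  {R : Opens E} {e : R ≃ₜ E} {s t : ℝ}

/-- **The orbit space `Y` of §0 for the polar family is a smooth manifold modelled on `E`** (in
the tree `E = ℝ⁴`): for a diffeomorphism `d : R⁴_s ≅ R⁴_t`, `s < t`, `s < 1`, the orbit space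
of `σ = incl ∘ d⁻¹ : R⁴_t → R⁴_t` with the atlas `EndPeriodic.orbitChartedSpace` (local
inverses of the projection; the compact `C` is the closed polar ball `{(1 - s) ‖e ·‖ ≤ 1}`) is a
`C^∞` manifold — and (`ExoticOpenFourSpaceOrbitSpaceProofs`) compact and Hausdorff. What the
source does with `Y` next (a Riemannian metric on `Y`, the end-periodic metrics, `Φ`) is not
formalized. [cite: DeMichelisFreedman1992, §0 (p. 220), §2 (p. 223); proof of Thm. 4.1, p. 247] -/
theorem isManifold_orbitSpace_inclusion_comp_symm (hst : s < t) (hs1 : s < 1)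
    (d : polarBall R e s ≃ₘ⟮𝓘(ℝ, E), 𝓘(ℝ, E)⟯ polarBall R e t) :
    letI : LocallyCompactSpace (polarBall R e t) := (polarBall R e t).isOpen.locallyCompactSpace
    letI := EndPeriodic.orbitChartedSpace
      (EndPeriodic.isOpenEmbedding_inclusion_comp_symm_opens (polarBall_mono R e hst.le) d)
      (isCompact_preimage_val_setOf_mul_norm_le R e hst hs1)
      (range_inclusion_comp_symm_subset hst.le d)
    IsManifold 𝓘(ℝ, E) ∞
      (EndPeriodic.OrbitSpace (Opens.inclusion (polarBall_mono R e hst.le) ∘ d.symm)) := by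
  letI : LocallyCompactSpace (polarBall R e t) := (polarBall R e t).isOpen.locallyCompactSpace
  exact EndPeriodic.isManifold_orbitSpace (polarBall_mono R e hst.le) d
    (isCompact_preimage_val_setOf_mul_norm_le R e hst hs1) (range_inclusion_comp_symm_subset hst.le d)

end PolarOrbitManifold

end Literature.Barriers.SmoothPoincare4

end
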